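import Mathlib.LinearAlgebra.Matrix.Adjugate
import Mathlib.LinearAlgebra.Matrix.Determinant.Basic
import Mathlib.Data.Real.Basic
import HarnessLib

/-!
# `StokesGeneration` (stmt-KontsevichZagierPeriods-3586) — line `fibrewise_stokes`,
# stub `stub_adjugate_blockTriangular`

Registered pure-matrix stub K1 (rung 15, change of variables for a face-preserving self-map of the
closed cube) of the line `fibrewise_stokes` of the crux `StokesGeneration` (route UnfoldedStokes).

The Jacobian matrix of the suspension `F (x, t) = ((1 - t) x + t Φ x, t)` on `ℝ^{N+1}` is block
upper-triangular, `M = [[A, v], [0, 1]]` (last row `e_last`).  The stub identifies the adjugate of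
such a matrix in terms of the top-left block `A = M.submatrix castSucc castSucc`:
(a) `adj(M)_{last,last} = det A`; (b) the top-left block of `adj(M)` is `adj(A)`;
(c) `adj(M)_{j,last} = -(adj(A) v)_j`.

Proof. (a) is the cofactor formula `Matrix.adjugate_fin_succ_eq_det_submatrix` with
`Fin.succAbove_last`.  (b) `adj(M)_{j l} = det (M.updateRow l e_j)` (`Matrix.adjugate_apply`); for
`j l < last` the updated matrix still has last row `e_last`, so Laplace expansion along the last
row (`Matrix.det_succ_row`) reduces its determinant to that of its `castSucc`-submatrix, which is
`A.updateRow l e_j`.  (c) the off-diagonal entry `(adj(M) M)_{j,last} = 0` of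
`adj(M) M = det M • 1` (`Matrix.adjugate_mul`) expands (`Fin.sum_univ_castSucc`, last row of `M`)
to `∑ l, adj(M)_{j l} M_{l,last} + adj(M)_{j,last} = 0`; insert (b).

References: M. Kontsevich, D. Zagier, *Periods* (2001), §1.2 (rule (2), change of variables);
adjugate / Laplace expansion (Mathlib `Mathlib.LinearAlgebra.Matrix.Adjugate`).
-/

noncomputable section

-- `Summit.KontsevichZagierPeriods.KontsevichZagierPeriods.…` is the tree's mandated layout (single-conjunct summit).
set_option linter.dupNamespace false

namespace Summit.KontsevichZagierPeriods.KontsevichZagierPeriods.Cruxes.StokesGeneration.FibrewiseStokes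

open Matrix

/-- Laplace expansion along a last row equal to `e_last`: the determinant of a square matrix of
size `N + 1` whose last row is `(0, …, 0, 1)` is the determinant of its top-left `N × N` block.
[folklore] -/
theorem blockTri_det_of_lastRow {N : ℕ} (B : Matrix (Fin (N + 1)) (Fin (N + 1)) ℝ)
    (hrow : ∀ l : Fin N, B (Fin.last N) (Fin.castSucc l) = 0)
    (hone : B (Fin.last N) (Fin.last N) = 1) :
    B.det = (B.submatrix Fin.castSucc Fin.castSucc).det := by
  rw [det_succ_row B (Fin.last N), Fin.sum_univ_castSucc]
  simp only [hrow, mul_zero, zero_mul, Finset.sum_const_zero, zero_add, hone, mul_one,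
    Fin.succAbove_last, Fin.val_last]
  rw [← two_mul, pow_mul, neg_one_sq, one_pow, one_mul]

/-- Updating a non-last row by a unit vector `e_{castSucc j}` commutes with passing to the top-left
block. [folklore] -/
theorem blockTri_submatrix_updateRow {N : ℕ} (M : Matrix (Fin (N + 1)) (Fin (N + 1)) ℝ)
    (j l : Fin N) :
    (M.updateRow (Fin.castSucc l) (Pi.single (Fin.castSucc j) 1)).submatrix Fin.castSucc
        Fin.castSucc =
      (M.submatrix Fin.castSucc Fin.castSucc).updateRow l (Pi.single j 1) := by
  ext a b
  simp only [submatrix_apply, updateRow_apply, Fin.castSucc_inj, Pi.single_apply]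

/-- **Registered stub `stub_adjugate_blockTriangular` (rung 15, K1): adjugate of a block
upper-triangular matrix `M = [[A, v], [0, 1]]`.** With `A = M.submatrix castSucc castSucc`:
`adj(M)_{last,last} = det A`, the top-left block of `adj(M)` is `adj(A)`, and
`adj(M)_{j,last} = -∑ l, adj(A)_{j l} M_{l,last}`. [folklore] -/
theorem stub_adjugate_blockTriangular {N : ℕ} (M : Matrix (Fin (N + 1)) (Fin (N + 1)) ℝ)
    (hrow : ∀ l : Fin N, M (Fin.last N) (Fin.castSucc l) = 0)
    (hone : M (Fin.last N) (Fin.last N) = 1) :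
    M.adjugate (Fin.last N) (Fin.last N) = (M.submatrix Fin.castSucc Fin.castSucc).det ∧
    (∀ j l : Fin N, M.adjugate (Fin.castSucc j) (Fin.castSucc l) =
      (M.submatrix Fin.castSucc Fin.castSucc).adjugate j l) ∧
    (∀ j : Fin N, M.adjugate (Fin.castSucc j) (Fin.last N) =
      -∑ l : Fin N, (M.submatrix Fin.castSucc Fin.castSucc).adjugate j l *
        M (Fin.castSucc l) (Fin.last N)) := by
  -- (a) cofactor formula at `(last, last)`
  have ha : M.adjugate (Fin.last N) (Fin.last N) = (M.submatrix Fin.castSucc Fin.castSucc).det := by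
    rw [adjugate_fin_succ_eq_det_submatrix, Fin.succAbove_last, Fin.val_last, ← two_mul, pow_mul,
      neg_one_sq, one_pow, one_mul]
  -- (b) the top-left block of `adj M` is `adj A`
  have hb : ∀ j l : Fin N, M.adjugate (Fin.castSucc j) (Fin.castSucc l) =
      (M.submatrix Fin.castSucc Fin.castSucc).adjugate j l := by
    intro j l
    rw [adjugate_apply, adjugate_apply, blockTri_det_of_lastRow, blockTri_submatrix_updateRow]
    · intro l'
      rw [updateRow_ne (Fin.castSucc_lt_last l).ne', hrow]
    · rw [updateRow_ne (Fin.castSucc_lt_last l).ne', hone]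
  refine ⟨ha, hb, fun j => ?_⟩
  -- (c) off-diagonal entry `(castSucc j, last)` of `adj M * M = det M • 1`
  have h0 : (M.adjugate * M) (Fin.castSucc j) (Fin.last N) = 0 := by
    rw [adjugate_mul, Matrix.smul_apply, one_apply_ne (Fin.castSucc_lt_last j).ne, smul_zero]
  rw [mul_apply, Fin.sum_univ_castSucc, hone, mul_one] at h0
  simp only [hb] at h0
  exact eq_neg_of_add_eq_zero_right h0

end Summit.KontsevichZagierPeriods.KontsevichZagierPeriods.Cruxes.StokesGeneration.FibrewiseStokes

end
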